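import Literature.NumberTheory.Automorphic.BockleHuiIrreducibleGL3
import Literature.NumberTheory.GaloisRepresentations.WeakAbelianDirectSummand
import Literature.NumberTheory.Automorphic.AutomorphicRepsGLSatakeFlathProofs
import HarnessLib

/-!
# Böckle–Hui 2025, Theorem 1.2 — the proved skeleton of the printed proof (§3.2.1)

Topic `NumberTheory/Automorphic`; namespaces `Literature.NumberTheory.GaloisRepresentations` (the
representation-theoretic steps) and `Literature.NumberTheory.Automorphic` (the steps that mention
`π`).  Sibling PROOFS file of `BockleHuiIrreducibleGL3.lean`, whose named fact
`isIrreducible_galoisRep_gl3_totallyReal` (Böckle–Hui, Math. Ann. 393 (2025), Thm. 1.2 =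
"Theorem (main)", arXiv:2404.08954 p. 13) is NOT discharged here: its printed proof rests on
inputs that are theories of their own (below).  This file proves, sorry-free, the steps of the
printed proof that are elementary, and assembles the theorem from the remaining printed inputs
stated as explicit hypotheses (no new named facts, D-0026), so that their Lean phrasing is fixed.

Source (held arXiv text `paper:arxiv-2404.08954`, §3.2.1, p. 13):

> "If `ρ_λ` is reducible, we have a decomposition `ρ_λ = σ_λ ⊕ τ_λ` where `σ_λ` is
> two-dimensional and `τ_λ` is a character. Then [(Alt): three identities of representations].
> Since `τ_λ` is locally algebraic by Theorem 1.1, it comes from an algebraic Hecke character `τ`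
> of `K`. Since `ρ_λ` is unramified outside `S' = S ∪ S_ℓ`, we obtain from (Alt) and the
> local-global compatibility (lg) an equation on partial L-functions
> `L^{S'}(1,s) L^{S'}(Alt²(π) ⊗ ψ₁, s) = L^{S'}(π ⊗ ψ₂, s) L^{S'}(ψ₃, s)` … Suppose
> `det(σ_λ)·τ_λ^{-2}` is non-trivial. … We get a contradiction [pole of `L(1,s)` at `s = 1`,
> Shahidi [Sh97], finiteness of the right-hand side]. Suppose `det(σ_λ)·τ_λ^{-2}` is trivial. Then
> `ρ_λ ⊗ τ_λ^{-1}` is self-dual. Since `τ_λ` is locally algebraic, `π` is essentially self-dual by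
> multiplicity one [JS81]. But in this case, `ρ_λ` is irreducible (see [Hu23a]). We conclude that
> `ρ_λ` is irreducible."

## What is proved here

* `exists_subrepresentation_finrank_eq_one_of_not_isIrreducible`,
  `exists_stableLine_of_finrank_eq_one` — a semisimple (Mathlib
  `Representation.IsSemisimpleRepresentation`) representation of dimension `3` over a field which
  is not irreducible (Mathlib `Representation.IsIrreducible`) has a one-dimensional
  subrepresentation, i.e. a stable line (a proper non-trivial subrepresentation has dimension `1`
  or `2`, and a complement of a plane is a line).
* `FramedRep.exists_rankOne_of_stableLine` — the scalar by which a topological group acts on a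
  stable line of a framed continuous representation `G →ₜ* GL_n(A)` is a continuous character,
  packaged as a rank-one framed representation `τ : G →ₜ* GL_1(A)` with `r(g) x = det(τ g) • x`.
* `FramedGaloisRep.exists_stableLine_of_not_isIrreducible` — Step 1 of §3.2.1 for the tree's
  `r : Γ_K →ₜ* GL_3(A)`: semisimple and not irreducible ⇒ a character `τ` on an `r`-stable line,
  in exactly the hypothesis shape of `GaloisRepresentations.exists_heckeCharacter_of_stableLine`
  (the stable-line corollary of BH Thm. 1.1) and of the route
  `Summits/Langlands/…/Theses/ReducibleSelfDual`.
* `eventually_isUnramifiedAt_of_satakeCompatible` — an `r` with the unramified compatibility of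
  lang.S27 (the hypothesis of the named fact) is unramified, with the predicted Frobenius
  characteristic polynomial, at all but finitely many places (Flath:
  `AutomorphicRepData.hasSatakeParamAt_cofinite_holds`; finitely many places above `ℓ`).
* `weaklyDivides_of_stableLine_of_satakeCompatible` — hence the character on a stable line is a
  weak abelian direct summand of `r` (BH §1.1, Def. 2.3; tree `FramedGaloisRep.WeaklyDivides`).
* `stableLine_isUnramifiedAt_and_det_eq` — at a place `v ∤ ℓ` where `π` has Satake parameter `α`,
  the character `τ` is unramified and `det τ(Frob_v^{arith}) = ι⁻¹((q_v^{(n-1)/2} a)⁻¹)` for some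
  `a ∈ α` (the unramified local information on `τ_λ` read off from (lg)).
* `reducible_forces_essSelfDual_gl3_totallyReal_of` — §3.2.1 up to its last sentence, assembled:
  from BH Thm. 1.1 (the in-tree named fact
  `GaloisRepresentations.exists_heckeCharacter_of_weaklyDivides`), the `E`-rationality of `r`
  (BH §3.1, Clozel; hypothesis) and the `L`-function dichotomy (hypothesis: a Hecke-algebraic
  character on a stable line forces essential self-duality of `π` at Satake level), a reducible
  semisimple compatible `r` forces `π` to be essentially self-dual.  Proved glue: Step 1 and the
  stable-line corollary of Thm. 1.1.
* `isIrreducible_galoisRep_gl3_totallyReal_of_reducibleForcesEssSelfDual_of_hui` — the named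
  fact from "reducible ⇒ essentially self-dual" and the [Hu23a] input "essentially self-dual ⇒
  irreducible" (pure logic, as in the last two sentences of the printed proof).

## Status of the printed inputs in the tree (why the fact is not discharged)

* Theorem 1.1 (weak abelian direct summands of `E`-rational semisimple `ρ` are locally algebraic):
  named fact `GaloisRepresentations.exists_heckeCharacter_of_weaklyDivides`, unproved
  (Serre–Waldschmidt theory and algebraic monodromy groups, BH §2).
* `E`-rationality of `ρ_{π,ι}` (BH §3.1; Clozel 1990 Thm. 3.13): cf. the named fact
  `Clozel1990_regularAlgebraic` (rationality field `ℚ(π_f)` a number field); the passage to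
  `FramedGaloisRep.IsRationalOver` is not in the tree.
* The `L`-function dichotomy: partial Rankin–Selberg / standard `L`-functions of Jacquet–Shalika
  are in the tree (`JacquetShalika1981_*`), but not twists by algebraic Hecke characters of
  infinite order, `Alt²`, Shahidi's non-vanishing theorem [Sh97], nor the Galois-to-automorphic
  `L`-function bridge; this is crux `ReducibleForcesEssSelfDual` of the route `ReducibleSelfDual`.
* [Hu23a] (C.-Y. Hui, J. Lond. Math. Soc. 108 (2023), Thm. 1.4 and §4.4: irreducibility for
  polarized regular algebraic `π`, `n ≤ 6`, via big monodromy and potential automorphy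
  [BLGGT14]): absent from the tree.

Essential self-duality of `π` is rendered at Satake level, `{a⁻¹ : a ∈ α_v} = {η(ϖ_v) a : a ∈ α_v}`
for a Hecke character `η` at almost all `v` (the unramified shadow of `π^∨ ≅ π ⊗ η`, equivalent to
it by strong multiplicity one; the rendering of the route `ReducibleSelfDual` and of
`EssConjSelfDual.lean`).

## References

* G. Böckle, C.-Y. Hui, *Weak abelian direct summands and irreducibility of Galois
  representations*, Math. Ann. 393 (2025) 543–569, Thm. 1.1, Thm. 1.2, §1.1, Def. 2.3, §3.1,
  §3.2.1. [BockleHui2025]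
* C.-Y. Hui, *Monodromy of subrepresentations and irreducibility of low degree automorphic Galois
  representations*, J. Lond. Math. Soc. 108 (2023), Thm. 1.4, §4.4 (`doi:10.1112/jlms.12811`,
  arXiv:2208.04002).
* H. Jacquet, J. Shalika, *On Euler products and the classification of automorphic forms II*,
  Amer. J. Math. 103 (1981). [JacquetShalika1981]
* F. Shahidi, *On non-vanishing of twisted symmetric and exterior square L-functions for GL(n)*,
  Pacific J. Math. 181 (1997) 311–322.
-/

noncomputable section

-- (H5) the place subtypes indexing the factors of `mixedSpace K` use classical `Fintype` instances
open scoped NumberField Matrix Polynomial Classical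
open NumberField IsDedekindDomain Field Polynomial Filter

namespace Literature.NumberTheory.GaloisRepresentations

/-! ### Step 1 of BH §3.2.1: a reducible semisimple three-dimensional representation has a
stable line -/

section StableLine

variable {A G V : Type*} [Field A] [Group G] [AddCommGroup V] [Module A V] [FiniteDimensional A V]

/-- **A semisimple, reducible representation of dimension `3` has a one-dimensional
subrepresentation.**  If `ρ` is not irreducible there is a subrepresentation `W ≠ ⊥, ⊤`, of
dimension `1` or `2`; in the second case a complement of `W` (semisimplicity) has dimension `1`.
This is the first sentence of the proof of BH Thm. 1.2: "If `ρ_λ` is reducible, we have a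
decomposition `ρ_λ = σ_λ ⊕ τ_λ` where `σ_λ` is two-dimensional and `τ_λ` is a character."
[cite: BockleHui2025, §3.2.1] -/
theorem exists_subrepresentation_finrank_eq_one_of_not_isIrreducible (ρ : Representation A G V)
    (h3 : Module.finrank A V = 3) (hss : ρ.IsSemisimpleRepresentation) (hirr : ¬ ρ.IsIrreducible) :
    ∃ W : Subrepresentation ρ, Module.finrank A W.toSubmodule = 1 := by
  classical
  have hbot : (⊥ : Subrepresentation ρ).toSubmodule = ⊥ := rfl
  have htop : (⊤ : Subrepresentation ρ).toSubmodule = ⊤ := rfl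
  -- the lattice of subrepresentations is nontrivial (`V ≠ 0`)
  haveI hnt : Nontrivial (Subrepresentation ρ) := by
    refine ⟨⟨⊥, ⊤, fun h => ?_⟩⟩
    have h0 : Module.finrank A (⊥ : Submodule A V) = Module.finrank A (⊤ : Submodule A V) := by
      rw [← hbot, ← htop, h]
    rw [finrank_bot, finrank_top, h3] at h0
    exact absurd h0 (by norm_num)
  -- not irreducible: a subrepresentation other than `⊥` and `⊤`
  obtain ⟨W, hWb, hWt⟩ : ∃ W : Subrepresentation ρ, W ≠ ⊥ ∧ W ≠ ⊤ := by
    by_contra hcon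
    push Not at hcon
    exact hirr { eq_bot_or_eq_top := fun W => (eq_or_ne W ⊥).imp_right (hcon W) }
  have hWb' : W.toSubmodule ≠ ⊥ := fun h => hWb (Subrepresentation.toSubmodule_injective (h.trans hbot.symm))
  have hWt' : W.toSubmodule ≠ ⊤ := fun h => hWt (Subrepresentation.toSubmodule_injective (h.trans htop.symm))
  have h1 : Module.finrank A W.toSubmodule ≠ 0 := fun h => hWb' (Submodule.finrank_eq_zero.1 h)
  have h2 : Module.finrank A W.toSubmodule < 3 := h3 ▸ Submodule.finrank_lt hWt'
  by_cases hW1 : Module.finrank A W.toSubmodule = 1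
  · exact ⟨W, hW1⟩
  -- `dim W = 2`: take a complement
  have hW2 : Module.finrank A W.toSubmodule = 2 := by omega
  haveI := hss
  obtain ⟨W', hWW'⟩ := exists_isCompl W
  have hc : IsCompl W.toSubmodule W'.toSubmodule := by
    refine IsCompl.of_eq ?_ ?_
    · rw [← Subrepresentation.toSubmodule_inf, hWW'.inf_eq_bot, hbot]
    · rw [← Subrepresentation.toSubmodule_sup, hWW'.sup_eq_top, htop]
  have hsum := Submodule.finrank_add_eq_of_isCompl hc
  rw [hW2, h3] at hsum
  exact ⟨W', by omega⟩

/-- **A one-dimensional subrepresentation is a stable line**: there is `x ≠ 0` such that every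
`ρ g x` is a multiple of `x`. [folklore] -/
theorem exists_stableLine_of_finrank_eq_one (ρ : Representation A G V)
    {W : Subrepresentation ρ} (hW : Module.finrank A W.toSubmodule = 1) :
    ∃ x : V, x ≠ 0 ∧ ∀ g : G, ∃ c : A, ρ g x = c • x := by
  obtain ⟨v, hv0, hv⟩ := finrank_eq_one_iff'.1 hW
  refine ⟨(v : V), fun h => hv0 (Subtype.ext h), fun g => ?_⟩
  obtain ⟨c, hc⟩ := hv ⟨ρ g v, W.apply_mem_toSubmodule g v.2⟩
  exact ⟨c, by simpa using congrArg Subtype.val hc.symm⟩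

end StableLine

/-! ### The character of a stable line as a rank-one framed representation -/

section Character

variable {G : Type*} [Group G] [TopologicalSpace G] [IsTopologicalGroup G]
  {A : Type*} [Field A] [TopologicalSpace A] [IsTopologicalRing A] {n : ℕ}

/-- **The character of a stable line is continuous.**  If `x ≠ 0` spans a line stable under the
framed continuous representation `r : G →ₜ* GL_n(A)` (`A` a topological field, `G` a topological
group), then the scalar by which `G` acts on `x` is a continuous character, i.e. there is a
rank-one framed representation `τ : G →ₜ* GL_1(A)` with `r(g) x = det(τ g) • x` for all `g`
(the scalar is `(r(g)x)_i / x_i` for any `i` with `x_i ≠ 0`, a continuous function of `g`; its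
inverse is its value at `g⁻¹`).  This is the "character `τ_λ`" of BH §3.2.1 in the framed
language of the tree (`FramedRep`, `FramedRep.unitsContinuousMulEquivOfUnique`). [folklore] -/
theorem FramedRep.exists_rankOne_of_stableLine (r : FramedRep G A n) {x : Fin n → A} (hx0 : x ≠ 0)
    (hx : ∀ g : G, ∃ c : A, r.toRepresentation g x = c • x) :
    ∃ τ : FramedRep G A 1, ∀ g : G,
      r.toRepresentation g x = ((Matrix.GeneralLinearGroup.det (τ g) : Aˣ) : A) • x := by
  classical
  choose c hc using hx
  obtain ⟨i, hi⟩ : ∃ i, x i ≠ 0 := Function.ne_iff.mp hx0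
  -- the scalar in coordinates
  have hci : ∀ g, c g = (r.toRepresentation g x) i * (x i)⁻¹ := fun g => by
    rw [hc g, Pi.smul_apply, smul_eq_mul, mul_inv_cancel_right₀ hi]
  have hcoord : ∀ g, (r.toRepresentation g x) i = c g * x i := fun g => by
    rw [hc g, Pi.smul_apply, smul_eq_mul]
  have hc1 : c 1 = 1 := by
    have h := hcoord 1
    rw [map_one, Module.End.one_apply] at h
    exact (mul_eq_right₀ hi).1 h.symm
  have hcmul : ∀ g h, c (g * h) = c g * c h := by
    intro g h
    have e1 : r.toRepresentation (g * h) x = (c g * c h) • x := by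
      rw [map_mul, Module.End.mul_apply, hc h, map_smul, hc g, smul_smul, mul_comm]
    have e2 := congrFun e1 i
    rw [hcoord (g * h), Pi.smul_apply, smul_eq_mul] at e2
    exact mul_right_cancel₀ hi e2
  have hc0 : ∀ g, c g ≠ 0 := fun g h0 => by
    have h := hcmul g g⁻¹
    rw [mul_inv_cancel, hc1, h0, zero_mul] at h
    exact one_ne_zero h
  have hcinv : ∀ g, (c g)⁻¹ = c g⁻¹ := fun g => by
    have h := hcmul g g⁻¹
    rw [mul_inv_cancel, hc1] at h
    exact inv_eq_of_mul_eq_one_right h.symm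
  -- continuity of the scalar
  have hcont : Continuous c := by
    have h1 : Continuous fun g => ((r g : GL (Fin n) A) : Matrix (Fin n) (Fin n) A) *ᵥ x :=
      (Units.continuous_val.comp (map_continuous r)).matrix_mulVec continuous_const
    have h2 : Continuous fun g => (r.toRepresentation g x) i :=
      (continuous_apply i).comp h1
    have : c = fun g => (r.toRepresentation g x) i * (x i)⁻¹ := funext hci
    rw [this]
    exact h2.mul continuous_const
  -- the continuous units-valued character
  let χ : G →ₜ* Aˣ :=
    { toFun := fun g => Units.mk0 (c g) (hc0 g)
      map_one' := Units.ext hc1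
      map_mul' := fun g h => Units.ext (hcmul g h)
      continuous_toFun := by
        refine Units.continuous_iff.2 ⟨hcont, ?_⟩
        have : (fun g => ((Units.mk0 (c g) (hc0 g))⁻¹ : Aˣ) : G → A) = fun g => c g⁻¹ := by
          funext g
          rw [Units.val_inv_eq_inv_val, Units.val_mk0, hcinv]
        rw [this]
        exact hcont.comp continuous_inv }
  refine ⟨(FramedRep.unitsContinuousMulEquivOfUnique (Fin 1) A : Aˣ →ₜ* GL (Fin 1) A).comp χ,
    fun g => ?_⟩
  rw [hc g]
  congr 1
  rw [Matrix.GeneralLinearGroup.val_det_apply, Matrix.det_unique]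
  rfl

end Character

/-! ### Step 1 for Galois representations: `ρ_λ = σ_λ ⊕ τ_λ` yields a stable line with a
continuous character -/

section Galois

variable {K : Type*} [Field K] {A : Type*} [Field A] [TopologicalSpace A] [IsTopologicalRing A]

/-- **BH §3.2.1, first step, in the language of the tree.**  A continuous semisimple
`r : Γ_K →ₜ* GL_3(A)` (`A` a topological field) which is *not* irreducible admits a character
`τ : Γ_K →ₜ* GL_1(A)` occurring on an `r`-stable line: `r(g) x = det(τ g) • x` for some `x ≠ 0`
and all `g ∈ Γ_K` ("If `ρ_λ` is reducible, we have a decomposition `ρ_λ = σ_λ ⊕ τ_λ` where `σ_λ`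
is two-dimensional and `τ_λ` is a character").  This is exactly the hypothesis shape of
`exists_heckeCharacter_of_stableLine` (the stable-line corollary of BH Thm. 1.1) and of the
route `Summits/Langlands/…/Theses/ReducibleSelfDual`. [cite: BockleHui2025, §3.2.1] -/
theorem FramedGaloisRep.exists_stableLine_of_not_isIrreducible (r : FramedGaloisRep K A 3)
    (hss : r.toGaloisRep.IsSemisimple) (hirr : ¬ r.toGaloisRep.IsIrreducible) :
    ∃ (τ : FramedGaloisRep K A 1) (x : Fin 3 → A), x ≠ 0 ∧ ∀ g : absoluteGaloisGroup K,
      r.toGaloisRep g x = ((Matrix.GeneralLinearGroup.det (τ g) : Aˣ) : A) • x := by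
  have h3 : Module.finrank A (Fin 3 → A) = 3 := Module.finrank_fin_fun A
  obtain ⟨W, hW⟩ := exists_subrepresentation_finrank_eq_one_of_not_isIrreducible
    (FramedRep.toRepresentation r) h3 hss hirr
  obtain ⟨x, hx0, hx⟩ := exists_stableLine_of_finrank_eq_one _ hW
  obtain ⟨τ, hτ⟩ := FramedRep.exists_rankOne_of_stableLine r hx0 hx
  exact ⟨τ, x, hx0, hτ⟩

end Galois

end Literature.NumberTheory.GaloisRepresentations

/-! ### Step 2 of BH §3.2.1 for the tree's `r`: almost-everywhere unramifiedness, and the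
Frobenius values of the character on the stable line -/

namespace Literature.NumberTheory.Automorphic

open GaloisRepresentations

section Compatible

variable {K : Type} [Field K] [NumberField K] {n : ℕ} {hcpt : isCompact_glFiniteIntegralLevel n K}
  {ℓ : ℕ} [Fact ℓ.Prime]

/-- **An `r` with the unramified compatibility of lang.S27 is unramified, with the predicted
Frobenius characteristic polynomial, at all but finitely many places** (BH §3.1: "`ρ_{π,ι}` … is
`E`-rational and unramified outside `S`"; here: the places where `π` is ramified are finitely many
by Flath's theorem `AutomorphicRepData.hasSatakeParamAt_cofinite_holds`, and so are the places
above `ℓ`, Mathlib `Ideal.finite_factors`). [cite: BockleHui2025, §3.1] -/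
theorem eventually_isUnramifiedAt_of_satakeCompatible
    (π : AutomorphicRepData (AutomorphyDatum.gl n K hcpt)) (ι : PadicAlgCl ℓ ≃+* ℂ)
    (r : FramedGaloisRep K (PadicAlgCl ℓ) n)
    (hr : ∀ (v : HeightOneSpectrum (𝓞 K)) (α : Multiset ℂ), π.HasSatakeParamAt v α →
      ((ℓ : ℕ) : 𝓞 K) ∉ v.asIdeal →
        r.IsUnramifiedAt v ∧ r.HasFrobCharpolyAt v (arithFrobPolyOfSatake ι v.residueCard n α)) :
    ∀ᶠ v : HeightOneSpectrum (𝓞 K) in cofinite,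
      r.IsUnramifiedAt v ∧ ∃ α : Multiset ℂ, π.HasSatakeParamAt v α ∧
        r.HasFrobCharpolyAt v (arithFrobPolyOfSatake ι v.residueCard n α) := by
  have hℓ : ∀ᶠ v : HeightOneSpectrum (𝓞 K) in cofinite, ((ℓ : ℕ) : 𝓞 K) ∉ v.asIdeal := by
    have hne : Ideal.span {((ℓ : ℕ) : 𝓞 K)} ≠ ⊥ := by
      rw [Ne, Ideal.span_singleton_eq_bot]
      exact_mod_cast (Fact.out : ℓ.Prime).ne_zero
    refine Filter.mem_of_superset (Ideal.finite_factors hne).compl_mem_cofinite ?_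
    intro v hv hmem
    exact hv (Ideal.dvd_span_singleton.2 hmem)
  have hcof : ∀ᶠ v : HeightOneSpectrum (𝓞 K) in cofinite, π.IsUnramifiedAt v :=
    π.hasSatakeParamAt_cofinite_holds
  filter_upwards [hcof, hℓ] with v hv hvℓ
  obtain ⟨α, hα⟩ := hv
  exact ⟨(hr v α hα hvℓ).1, α, hα, (hr v α hα hvℓ).2⟩

/-- **The character on a stable line of a compatible `r` is a weak abelian direct summand**
(BH §1.1: "Abelian direct summands (i.e., subrepresentations) of `ρ_ℓ` are obvious examples of
weak abelian direct summands"): `τ.WeaklyDivides r` in the sense of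
`GaloisRepresentations.FramedGaloisRep.WeaklyDivides` (Def. 2.3), by
`FramedGaloisRep.weaklyDivides_of_stableLine` and the almost-everywhere unramifiedness of a
compatible `r`. [cite: BockleHui2025, §1.1 and Definition 2.3] -/
theorem weaklyDivides_of_stableLine_of_satakeCompatible
    (π : AutomorphicRepData (AutomorphyDatum.gl n K hcpt)) (ι : PadicAlgCl ℓ ≃+* ℂ)
    (r : FramedGaloisRep K (PadicAlgCl ℓ) n)
    (hr : ∀ (v : HeightOneSpectrum (𝓞 K)) (α : Multiset ℂ), π.HasSatakeParamAt v α →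
      ((ℓ : ℕ) : 𝓞 K) ∉ v.asIdeal →
        r.IsUnramifiedAt v ∧ r.HasFrobCharpolyAt v (arithFrobPolyOfSatake ι v.residueCard n α))
    {τ : FramedGaloisRep K (PadicAlgCl ℓ) 1}
    (hx : ∃ x : Fin n → PadicAlgCl ℓ, x ≠ 0 ∧ ∀ g : absoluteGaloisGroup K,
      r.toGaloisRep g x = ((Matrix.GeneralLinearGroup.det (τ g) : (PadicAlgCl ℓ)ˣ) : PadicAlgCl ℓ) • x) :
    τ.WeaklyDivides r :=
  FramedGaloisRep.weaklyDivides_of_stableLine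
    ((eventually_isUnramifiedAt_of_satakeCompatible π ι r hr).mono fun _ hv => hv.1) hx

/-- **The character on a stable line of a compatible `r` is unramified wherever `r` is, and its
value at an arithmetic Frobenius is an inverse twisted Satake eigenvalue.**  If
`r(g) x = det(τ g) • x` (`x ≠ 0`) and `π` has Satake parameter `α` at `v ∤ ℓ`, then `τ` is
unramified at `v` and for every arithmetic Frobenius `σ` at a prime above `v`,
`det τ(σ) = ι⁻¹((q_v^{(n-1)/2} a)⁻¹)` for some `a ∈ α` — an eigenvalue of `r(σ)` on the line is a
root of its characteristic polynomial `arithFrobPolyOfSatake ι q_v n α`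
(`roots_arithFrobPolyOfSatake`).  This is the unramified local information on `τ_λ` that BH read
off from "(Alt) and the local-global compatibility (lg)" in §3.2.1 (and the sense in which `τ_λ`
is a weak abelian direct summand, §1.1). [cite: BockleHui2025, §3.2.1] -/
theorem stableLine_isUnramifiedAt_and_det_eq
    (π : AutomorphicRepData (AutomorphyDatum.gl n K hcpt)) (ι : PadicAlgCl ℓ ≃+* ℂ)
    (r : FramedGaloisRep K (PadicAlgCl ℓ) n)
    (hr : ∀ (v : HeightOneSpectrum (𝓞 K)) (α : Multiset ℂ), π.HasSatakeParamAt v α →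
      ((ℓ : ℕ) : 𝓞 K) ∉ v.asIdeal →
        r.IsUnramifiedAt v ∧ r.HasFrobCharpolyAt v (arithFrobPolyOfSatake ι v.residueCard n α))
    {τ : FramedGaloisRep K (PadicAlgCl ℓ) 1} {x : Fin n → PadicAlgCl ℓ} (hx0 : x ≠ 0)
    (hx : ∀ g : absoluteGaloisGroup K,
      r.toGaloisRep g x = ((Matrix.GeneralLinearGroup.det (τ g) : (PadicAlgCl ℓ)ˣ) : PadicAlgCl ℓ) • x)
    {v : HeightOneSpectrum (𝓞 K)} {α : Multiset ℂ} (hα : π.HasSatakeParamAt v α)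
    (hvℓ : ((ℓ : ℕ) : 𝓞 K) ∉ v.asIdeal) :
    τ.IsUnramifiedAt v ∧
      ∀ 𝔓 ∈ v.primesAbove, ∀ σ : absoluteGaloisGroup K, IsArithFrobAt (𝓞 K) σ 𝔓 →
        ∃ a ∈ α, ((Matrix.GeneralLinearGroup.det (τ σ) : (PadicAlgCl ℓ)ˣ) : PadicAlgCl ℓ) =
          ι.symm ((((Real.sqrt (v.residueCard : ℝ) : ℝ) : ℂ) ^ (n - 1) * a)⁻¹) := by
  classical
  obtain ⟨hunr, hP⟩ := hr v α hα hvℓ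
  -- matrix form of the eigenvector equation
  have hmul : ∀ g : absoluteGaloisGroup K,
      ((r g : GL (Fin n) (PadicAlgCl ℓ)) : Matrix (Fin n) (Fin n) (PadicAlgCl ℓ)) *ᵥ x =
        ((Matrix.GeneralLinearGroup.det (τ g) : (PadicAlgCl ℓ)ˣ) : PadicAlgCl ℓ) • x := fun g => by
    simpa using hx g
  obtain ⟨i, hi⟩ : ∃ i, x i ≠ 0 := Function.ne_iff.mp hx0
  refine ⟨?_, ?_⟩
  · -- unramified: inertia acts trivially on `x ≠ 0`, so the scalar is `1`
    intro 𝔓 h𝔓 σ hσ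
    have h1 : r σ = 1 := hunr 𝔓 h𝔓 σ hσ
    have h2 := hmul σ
    rw [h1] at h2
    simp only [Units.val_one, Matrix.one_mulVec] at h2
    have h3 : ((Matrix.GeneralLinearGroup.det (τ σ) : (PadicAlgCl ℓ)ˣ) : PadicAlgCl ℓ) * x i = x i := by
      simpa using (congrFun h2 i).symm
    have hd : ((Matrix.GeneralLinearGroup.det (τ σ) : (PadicAlgCl ℓ)ˣ) : PadicAlgCl ℓ) = 1 :=
      (mul_eq_right₀ hi).1 h3
    refine Units.ext (Matrix.ext fun j k => ?_)
    have hdet : ((τ σ : GL (Fin 1) (PadicAlgCl ℓ)) : Matrix (Fin 1) (Fin 1) (PadicAlgCl ℓ)).det = 1 := by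
      rw [← Matrix.GeneralLinearGroup.val_det_apply, hd]
    rw [Matrix.det_fin_one] at hdet
    rw [Subsingleton.elim j 0, Subsingleton.elim k 0, hdet]
    simp
  · -- Frobenius value: an eigenvalue is a root of the characteristic polynomial
    intro 𝔓 h𝔓 σ hσ
    set d : PadicAlgCl ℓ := ((Matrix.GeneralLinearGroup.det (τ σ) : (PadicAlgCl ℓ)ˣ) : PadicAlgCl ℓ)
    have hchar : FramedRep.charpoly r σ = arithFrobPolyOfSatake ι v.residueCard n α := hP 𝔓 h𝔓 σ hσ
    have hroot : (FramedRep.charpoly r σ).IsRoot d := by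
      rw [IsRoot.def, FramedRep.charpoly, Matrix.eval_charpoly, ← Matrix.exists_mulVec_eq_zero_iff]
      refine ⟨x, hx0, ?_⟩
      rw [Matrix.sub_mulVec, hmul σ]
      ext j
      simp [Matrix.scalar_apply, d]
    have hne : arithFrobPolyOfSatake ι v.residueCard n α ≠ 0 := by
      refine (Polynomial.monic_multiset_prod_of_monic _ _ fun a _ => ?_).ne_zero
      exact Polynomial.monic_X_sub_C _
    have hmem : d ∈ (arithFrobPolyOfSatake ι v.residueCard n α).roots := by
      rw [Polynomial.mem_roots hne, ← hchar]
      exact hroot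
    rw [roots_arithFrobPolyOfSatake, Multiset.mem_map] at hmem
    obtain ⟨a, ha, hda⟩ := hmem
    exact ⟨a, ha, hda.symm⟩

end Compatible

/-! ### Assembly: Theorem 1.2 from the printed external inputs -/

section Assembly

/-- **BH §3.2.1, the reduction "reducible ⇒ essentially self-dual", assembled from its printed
inputs.**  Granting
* Böckle–Hui's Theorem 1.1 in its stable-line form (the in-tree named fact
  `GaloisRepresentations.exists_heckeCharacter_of_weaklyDivides`, hypothesis `hBH`),
* the `E`-rationality of every semisimple `r` compatible with a regular algebraic cuspidal `π`
  (BH §3.1: "By Clozel [Cl90], `π` is C-arithmetic … the semisimple `ℓ`-adic representation … is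
  `E`-rational"; hypothesis `hrat`, cf. the named fact `Clozel1990_regularAlgebraic`), and
* the `L`-function dichotomy of BH §3.2.1 (hypothesis `hL`): if the character `τ` on an
  `r`-stable line comes from an algebraic Hecke character, then — by the identity
  `L(1,s) L(Alt²(π) ⊗ ψ₁, s) = L(π ⊗ ψ₂, s) L(ψ₃, s)`, the pole of `ζ_K` at `s = 1`, Shahidi's
  non-vanishing [Sh97], the finiteness of the right-hand side for `ψ₃ ≠ 1`, and multiplicity one
  [JS81] when `ψ₃ = 1` — `π` is essentially self-dual, rendered at Satake level as in the route
  `ReducibleSelfDual`: for some Hecke character `η`, `{a⁻¹ : a ∈ α_v} = {η(ϖ_v) a : a ∈ α_v}` at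
  almost all `v`,
a reducible semisimple compatible `r` forces `π` (regular algebraic cuspidal on `GL_3` over a
totally real `K`) to be essentially self-dual.  Proved glue: Step 1
(`FramedGaloisRep.exists_stableLine_of_not_isIrreducible`) and the stable-line corollary of
Theorem 1.1 (`exists_heckeCharacter_of_stableLine`). [cite: BockleHui2025, §3.2.1] -/
theorem reducible_forces_essSelfDual_gl3_totallyReal_of
    (hBH : GaloisRepresentations.exists_heckeCharacter_of_weaklyDivides)
    (hrat : ∀ (K : Type) [Field K] [NumberField K], IsTotallyReal K →
      ∀ (hcpt : isCompact_glFiniteIntegralLevel 3 K) (π : CuspidalAutomorphicRepData 3 K hcpt),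
        π.1.IsRegularAlgebraic → ∀ (ℓ : ℕ) [Fact ℓ.Prime] (ι : PadicAlgCl ℓ ≃+* ℂ)
        (r : FramedGaloisRep K (PadicAlgCl ℓ) 3), r.toGaloisRep.IsSemisimple →
        (∀ (v : HeightOneSpectrum (𝓞 K)) (α : Multiset ℂ), π.1.HasSatakeParamAt v α →
            ((ℓ : ℕ) : 𝓞 K) ∉ v.asIdeal →
              r.IsUnramifiedAt v ∧ r.HasFrobCharpolyAt v (arithFrobPolyOfSatake ι v.residueCard 3 α)) →
        ∃ (E : Type) (_ : Field E) (_ : NumberField E) (e : E →+* PadicAlgCl ℓ), r.IsRationalOver e)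
    (hL : ∀ (K : Type) [Field K] [NumberField K], IsTotallyReal K →
      ∀ (hcpt : isCompact_glFiniteIntegralLevel 3 K) (π : CuspidalAutomorphicRepData 3 K hcpt),
        π.1.IsRegularAlgebraic → ∀ (ℓ : ℕ) [Fact ℓ.Prime] (ι : PadicAlgCl ℓ ≃+* ℂ)
        (r : FramedGaloisRep K (PadicAlgCl ℓ) 3), r.toGaloisRep.IsSemisimple →
        (∀ (v : HeightOneSpectrum (𝓞 K)) (α : Multiset ℂ), π.1.HasSatakeParamAt v α →
            ((ℓ : ℕ) : 𝓞 K) ∉ v.asIdeal →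
              r.IsUnramifiedAt v ∧ r.HasFrobCharpolyAt v (arithFrobPolyOfSatake ι v.residueCard 3 α)) →
        ∀ (τ : FramedGaloisRep K (PadicAlgCl ℓ) 1),
        (∃ x : Fin 3 → PadicAlgCl ℓ, x ≠ 0 ∧ ∀ g : absoluteGaloisGroup K,
          r.toGaloisRep g x =
            ((Matrix.GeneralLinearGroup.det (τ g) : (PadicAlgCl ℓ)ˣ) : PadicAlgCl ℓ) • x) →
        (∃ χ : HeckeCharacter K, χ.IsAlgebraic ∧
          ∀ᶠ v : HeightOneSpectrum (𝓞 K) in cofinite, χ.IsUnramifiedAt v ∧ τ.IsUnramifiedAt v ∧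
            τ.HasFrobCharpolyAt v (X - C (ι.symm (χ.valueAtUniformizer v)⁻¹))) →
        ∃ η : HeckeCharacter K, ∀ᶠ v : HeightOneSpectrum (𝓞 K) in cofinite,
          ∀ α : Multiset ℂ, π.1.HasSatakeParamAt v α →
            η.IsUnramifiedAt v ∧ α.map (fun a => a⁻¹) = α.map (fun a => η.valueAtUniformizer v * a))
    {K : Type} [Field K] [NumberField K] (hK : IsTotallyReal K)
    (hcpt : isCompact_glFiniteIntegralLevel 3 K) (π : CuspidalAutomorphicRepData 3 K hcpt)
    (hπ : π.1.IsRegularAlgebraic) (ℓ : ℕ) [Fact ℓ.Prime] (ι : PadicAlgCl ℓ ≃+* ℂ)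
    (r : FramedGaloisRep K (PadicAlgCl ℓ) 3) (hss : r.toGaloisRep.IsSemisimple)
    (hr : ∀ (v : HeightOneSpectrum (𝓞 K)) (α : Multiset ℂ), π.1.HasSatakeParamAt v α →
      ((ℓ : ℕ) : 𝓞 K) ∉ v.asIdeal →
        r.IsUnramifiedAt v ∧ r.HasFrobCharpolyAt v (arithFrobPolyOfSatake ι v.residueCard 3 α))
    (hirr : ¬ r.toGaloisRep.IsIrreducible) :
    ∃ η : HeckeCharacter K, ∀ᶠ v : HeightOneSpectrum (𝓞 K) in cofinite,
      ∀ α : Multiset ℂ, π.1.HasSatakeParamAt v α →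
        η.IsUnramifiedAt v ∧ α.map (fun a => a⁻¹) = α.map (fun a => η.valueAtUniformizer v * a) := by
  -- Step 1: a stable line with its continuous character
  obtain ⟨τ, x, hx0, hx⟩ := FramedGaloisRep.exists_stableLine_of_not_isIrreducible r hss hirr
  -- Step 2: `E`-rationality and Theorem 1.1: the character is an algebraic Hecke character
  obtain ⟨E, _, _, e, hre⟩ := hrat K hK hcpt π hπ ℓ ι r hss hr
  have hχ := exists_heckeCharacter_of_stableLine hBH e hss hre τ ⟨x, hx0, hx⟩ ι
  -- Step 3: the `L`-function dichotomy
  exact hL K hK hcpt π hπ ℓ ι r hss hr τ ⟨x, hx0, hx⟩ hχ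

/-- **Böckle–Hui, Theorem 1.2, assembled from the two external inputs of its printed proof
(§3.2.1).**  Granting
* (`hred`) the reduction of BH §3.2.1 up to its last sentence — for `K` totally real, `π` regular
  algebraic cuspidal on `GL_3(𝔸_K)` and a semisimple compatible `r` that is NOT irreducible, `π`
  is essentially self-dual at Satake level (Theorem 1.1 + Clozel + the `L`-function dichotomy;
  `reducible_forces_essSelfDual_gl3_totallyReal_of` assembles it from those), and
* (`hHui`) the last sentence, "But in this case, `ρ_λ` is irreducible (see [Hu23a])": for `K`
  totally real and `π` regular algebraic cuspidal on `GL_3(𝔸_K)` essentially self-dual, every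
  semisimple compatible `r` is irreducible (C.-Y. Hui, J. Lond. Math. Soc. 108 (2023), §4.4, via
  big monodromy and potential automorphy),
the named fact `isIrreducible_galoisRep_gl3_totallyReal` follows ("We conclude that `ρ_λ` is
irreducible").  Neither input is in the tree; this theorem only fixes their Lean phrasing and
checks the logic of the printed proof. [cite: BockleHui2025, Theorem 1.2 and §3.2.1] -/
theorem isIrreducible_galoisRep_gl3_totallyReal_of_reducibleForcesEssSelfDual_of_hui
    (hred : ∀ (K : Type) [Field K] [NumberField K], IsTotallyReal K →
      ∀ (hcpt : isCompact_glFiniteIntegralLevel 3 K) (π : CuspidalAutomorphicRepData 3 K hcpt),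
        π.1.IsRegularAlgebraic → ∀ (ℓ : ℕ) [Fact ℓ.Prime] (ι : PadicAlgCl ℓ ≃+* ℂ)
        (r : FramedGaloisRep K (PadicAlgCl ℓ) 3), r.toGaloisRep.IsSemisimple →
        (∀ (v : HeightOneSpectrum (𝓞 K)) (α : Multiset ℂ), π.1.HasSatakeParamAt v α →
            ((ℓ : ℕ) : 𝓞 K) ∉ v.asIdeal →
              r.IsUnramifiedAt v ∧ r.HasFrobCharpolyAt v (arithFrobPolyOfSatake ι v.residueCard 3 α)) →
        ¬ r.toGaloisRep.IsIrreducible →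
        ∃ η : HeckeCharacter K, ∀ᶠ v : HeightOneSpectrum (𝓞 K) in cofinite,
          ∀ α : Multiset ℂ, π.1.HasSatakeParamAt v α →
            η.IsUnramifiedAt v ∧ α.map (fun a => a⁻¹) = α.map (fun a => η.valueAtUniformizer v * a))
    (hHui : ∀ (K : Type) [Field K] [NumberField K], IsTotallyReal K →
      ∀ (hcpt : isCompact_glFiniteIntegralLevel 3 K) (π : CuspidalAutomorphicRepData 3 K hcpt),
        π.1.IsRegularAlgebraic →
        (∃ η : HeckeCharacter K, ∀ᶠ v : HeightOneSpectrum (𝓞 K) in cofinite,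
          ∀ α : Multiset ℂ, π.1.HasSatakeParamAt v α →
            η.IsUnramifiedAt v ∧ α.map (fun a => a⁻¹) = α.map (fun a => η.valueAtUniformizer v * a)) →
        ∀ (ℓ : ℕ) [Fact ℓ.Prime] (ι : PadicAlgCl ℓ ≃+* ℂ)
        (r : FramedGaloisRep K (PadicAlgCl ℓ) 3), r.toGaloisRep.IsSemisimple →
        (∀ (v : HeightOneSpectrum (𝓞 K)) (α : Multiset ℂ), π.1.HasSatakeParamAt v α →
            ((ℓ : ℕ) : 𝓞 K) ∉ v.asIdeal →
              r.IsUnramifiedAt v ∧ r.HasFrobCharpolyAt v (arithFrobPolyOfSatake ι v.residueCard 3 α)) →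
        r.toGaloisRep.IsIrreducible) :
    isIrreducible_galoisRep_gl3_totallyReal := by
  intro K _ _ hK hcpt π hπ ℓ _ ι r hss hr
  by_contra hirr
  exact hirr (hHui K hK hcpt π hπ (hred K hK hcpt π hπ ℓ ι r hss hr hirr) ℓ ι r hss hr)

end Assembly

end Literature.NumberTheory.Automorphic
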